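import Literature.Geometry.Lorentzian.ConvergenceTransport
import Literature.Geometry.Lorentzian.ExtensionProofs
import HarnessLib

/-!
# Future-directedness is stable under small tilts in a nearly flat chart

Topic `Geometry/Lorentzian` (namespace `Literature.Geometry.Lorentzian`). Let `Φ : U → 𝓢` be a
chart map of a `4`-dimensional spacetime defined on an open `U ⊆ ℝ⁴`, and suppose that at the point
`x ∈ U` the pulled-back metric is `C⁰`-close to the Minkowski form, `‖Φ^* g(x) − η‖ ≤ 1/8`
(the tree's `Spacetime.deviationExtend (Minkowski.backgroundOn U) Φ`). If the coordinate vector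
`Φ_* ∂₀` is future-directed at `x`, then so is `Φ_* u` for every `u ∈ ℝ⁴` with `‖u − ∂₀‖ ≤ 1/8`
(`Spacetime.isFutureDirected_mfderiv_of_norm_deviation_le`): both `Φ_* ∂₀` and `Φ_* u` are
`g`-timelike and `g(Φ_* ∂₀, Φ_* u) < 0`, because the three scalar products are those of the flat
form up to errors of size `‖Φ^* g(x) − η‖ · ‖·‖ ‖·‖`; a causal vector in the causal cone of a
future-directed timelike vector is future-directed (O'Neill 1983, Ch. 5, Lemma 5.26 and p. 145; the
tree's `TimeOrientation.isFutureDirected_of_val_lt_zero`). This is the pointwise linear algebra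
behind "time orientation is an open condition in `C⁰`" (flat identities `η(u, u) = ‖u‖² − 2 (u⁰)²`,
`η(∂₀, u) = −u⁰` from `ExtensionProofs.lean`, `KerrSchild.lean`). No definitions.

## References
* [ONeill1983] B. O'Neill, *Semi-Riemannian Geometry*, Academic Press 1983, Ch. 3, p. 55; Ch. 5,
  Lemma 5.26 and p. 145.
-/

noncomputable section

open Set Function TopologicalSpace
open scoped Manifold ContDiff Topology

namespace Literature.Geometry.Lorentzian

namespace Spacetime

-- the operator-norm and `PiLp` instance paths on `E4 →L[ℝ] E4 →L[ℝ] ℝ` unify slowly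
set_option maxSynthPendingDepth 3 in
/-- **Small tilts of a future-directed coordinate vector stay future-directed in a nearly flat
chart.** If `‖Φ^* g(x) − η‖ ≤ 1/8` and `Φ_* ∂₀` is future-directed at `x`, then `Φ_* u` is
future-directed for every `u` with `‖u − ∂₀‖ ≤ 1/8`: writing `G = Φ^* g(x) = η + dev`,
`G(∂₀, ∂₀) ≤ −1 + ‖dev‖ < 0`, `G(∂₀, u) ≤ −u⁰ + ‖dev‖ ‖u‖ < 0` and
`G(u, u) ≤ ‖u‖² − 2 (u⁰)² + ‖dev‖ ‖u‖² < 0` (`u⁰ ≥ 7/8`, `‖u‖ ≤ 9/8`), so `Φ_* u` is a causal vector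
in the causal cone of the future-directed timelike vector `Φ_* ∂₀` (O'Neill 1983, Ch. 5, Lemma 5.26
and p. 145). [cite: ONeill1983, Ch. 5, Lemma 5.26 and p. 145] -/
theorem isFutureDirected_mfderiv_of_norm_deviation_le (𝓢 : Spacetime 4) {U : Opens E4}
    (Φ : U → 𝓢.carrier) (x : U)
    (hfd : 𝓢.timeOrientation.IsFutureDirected
      (mfderiv 𝓘(ℝ, E4) (𝓡 4) Φ x (E4.basisVector 0)))
    (hdev : ‖𝓢.deviationExtend (Minkowski.backgroundOn U) Φ x‖ ≤ 1 / 8) {u : E4}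
    (hu : ‖u - E4.basisVector 0‖ ≤ 1 / 8) :
    𝓢.timeOrientation.IsFutureDirected (mfderiv 𝓘(ℝ, E4) (𝓡 4) Φ x u) := by
  set dev : E4 →L[ℝ] E4 →L[ℝ] ℝ := 𝓢.deviation (Minkowski.backgroundOn U) Φ x with hdev_def
  have hd : ‖dev‖ ≤ 1 / 8 := by rwa [𝓢.deviationExtend_coe] at hdev
  -- the chart metric at `x` is `dev + η`
  have hG : ∀ v w : E4, 𝓢.metric.val (Φ x) (mfderiv 𝓘(ℝ, E4) (𝓡 4) Φ x v)
      (mfderiv 𝓘(ℝ, E4) (𝓡 4) Φ x w) = dev v w + Minkowski.bilin v w := by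
    intro v w
    rw [hdev_def, Spacetime.deviation_apply]
    exact (sub_add_cancel _ _).symm
  have hdb : ∀ v w : E4, dev v w ≤ ‖dev‖ * ‖v‖ * ‖w‖ := fun v w ↦
    (le_abs_self _).trans (by simpa only [Real.norm_eq_abs] using dev.le_opNorm₂ v w)
  -- sizes of `∂₀` and `u`
  have he : ‖(E4.basisVector 0 : E4)‖ = 1 := by simp [E4.basisVector]
  have he0 : (E4.basisVector 0 : E4) 0 = 1 := by simp
  have hun : ‖u‖ ≤ 9 / 8 := by
    have h := norm_le_insert' u (E4.basisVector 0)
    rw [he] at h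
    linarith
  have hu0 : 7 / 8 ≤ u 0 ∧ u 0 ≤ 9 / 8 := by
    have h := PiLp.norm_apply_le (u - E4.basisVector 0) 0
    rw [Real.norm_eq_abs, PiLp.sub_apply, he0] at h
    constructor <;> linarith [(abs_le.mp (h.trans hu)).1, (abs_le.mp (h.trans hu)).2]
  -- the three scalar products
  have h00 : 𝓢.metric.val (Φ x) (mfderiv 𝓘(ℝ, E4) (𝓡 4) Φ x (E4.basisVector 0))
      (mfderiv 𝓘(ℝ, E4) (𝓡 4) Φ x (E4.basisVector 0)) < 0 := by
    rw [hG, Minkowski.bilin_basisVector_zero]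
    have h := hdb (E4.basisVector 0) (E4.basisVector 0)
    rw [he, mul_one, mul_one] at h
    linarith
  have h0u : 𝓢.metric.val (Φ x) (mfderiv 𝓘(ℝ, E4) (𝓡 4) Φ x (E4.basisVector 0))
      (mfderiv 𝓘(ℝ, E4) (𝓡 4) Φ x u) < 0 := by
    rw [hG, Minkowski.bilin_basisVector_zero_left]
    have h := hdb (E4.basisVector 0) u
    rw [he, mul_one] at h
    have h' : ‖dev‖ * ‖u‖ ≤ 1 / 8 * (9 / 8) :=
      mul_le_mul hd hun (norm_nonneg _) (by norm_num)
    linarith [hu0.1]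
  have huu : 𝓢.metric.val (Φ x) (mfderiv 𝓘(ℝ, E4) (𝓡 4) Φ x u)
      (mfderiv 𝓘(ℝ, E4) (𝓡 4) Φ x u) < 0 := by
    rw [hG, C0Extension.bilin_self_eq']
    have h := hdb u u
    have h' : ‖dev‖ * ‖u‖ * ‖u‖ ≤ 1 / 8 * (9 / 8) * (9 / 8) := by
      have h1 : ‖dev‖ * ‖u‖ ≤ 1 / 8 * (9 / 8) := mul_le_mul hd hun (norm_nonneg _) (by norm_num)
      exact mul_le_mul h1 hun (norm_nonneg _) (by norm_num)
    have h2 : ‖u‖ ^ 2 ≤ (9 / 8) ^ 2 := pow_le_pow_left₀ (norm_nonneg _) hun 2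
    have h3 : (7 / 8 : ℝ) ^ 2 ≤ u 0 ^ 2 := pow_le_pow_left₀ (by norm_num) hu0.1 2
    linarith
  -- a causal vector in the causal cone of a future-directed timelike vector is future-directed
  have hv0 : mfderiv 𝓘(ℝ, E4) (𝓡 4) Φ x u ≠ 0 := by
    intro h0
    rw [h0, map_zero] at huu
    exact lt_irrefl _ huu
  exact 𝓢.timeOrientation.isFutureDirected_of_val_lt_zero hfd h00 ⟨huu.le, hv0⟩ h0u

end Spacetime

end Literature.Geometry.Lorentzian

end
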